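import Summits.NavierStokesRegularity.NavierStokesRegularity.Theses.FlatSwirlGauge

/-!
# Route FlatSwirlGauge — `TypeIAssembly` (item stmt-NavierStokesRegularity-1257)

Pure logic: the Type-I variant of the route's assembly,
`FlatGaugeAtSingularity → FlatGaugeExcludesTypeI → NoTypeII → LocalBoundedExtends →
NoBlowupToClay → NavierStokesRegularity`.

Chain: `NoBlowupToClay` reduces Clay (A) to "no blow-up" (every classical Leray–Hopf solution
from a rapidly decaying datum on `[0, T)` extends smoothly past `T`). Given such `(ν, T, u, p)`,
argue by contradiction: if `u` has no smooth extension past `T`, then `(u, p)` is a maximal smooth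
solution (`IsMaximalSmoothSolution = classical ∧ ¬ HasSmoothExtensionPast`, definitional), so
`NoTypeII` gives the Type-I rate `IsTypeIBlowup u T`; at every `x₀` either `u` is already bounded
on a backward cylinder at `(T, x₀)`, or `FlatGaugeAtSingularity` supplies a flat swirl gauge there
and `FlatGaugeExcludesTypeI` turns it (with the Type-I rate) into boundedness on a backward
cylinder; `LocalBoundedExtends` then yields the smooth extension past `T` — contradiction.
-/

namespace Summit.NavierStokesRegularity.NavierStokesRegularity.Theorems

open Summit.NavierStokesRegularity.NavierStokesRegularity.Theses.FlatSwirlGauge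

/-- **TypeIAssembly** (item stmt-NavierStokesRegularity-1257, route FlatSwirlGauge): the route
statements `FlatGaugeAtSingularity`, `FlatGaugeExcludesTypeI`, `NoTypeII`, `LocalBoundedExtends`
and `NoBlowupToClay` imply `NavierStokesRegularity` — pure logic: reduce to no-blow-up, argue by
contradiction (no extension ⇒ maximal ⇒ Type I by `NoTypeII`), get boundedness on a backward
cylinder at every point (directly, or flat gauge + Type-I exclusion), and extend by
`LocalBoundedExtends`. -/
theorem flatSwirlGauge_typeIAssembly_proof : TypeIAssembly := by
  unfold TypeIAssembly
  intro hFG hTI hNT2 hLBE hClay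
  apply hClay
  intro ν T hν hT u p hcl hLH hdec
  by_contra hne
  have hmax : Literature.Analysis.FluidPDE.IsMaximalSmoothSolution ν 0 u p T := ⟨hcl, hne⟩
  have hrate : Literature.Analysis.FluidPDE.IsTypeIBlowup u T := hNT2 ν T hν hT u p hmax hLH hdec
  refine hne (hLBE ν T hν hT u p hcl hLH hdec ?_)
  intro x₀
  by_cases hb : (∃ r : ℝ, 0 < r ∧ ∃ K : ℝ, ∀ t ∈ Set.Ioo (T - r ^ 2) T, 0 ≤ t →
      ∀ x ∈ Metric.ball x₀ r, ‖u t x‖ ≤ K)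
  · exact hb
  · exact hTI ν T hν hT u p hcl hLH hdec hrate x₀ (hFG ν T hν hT u p hcl hLH hdec x₀ hb)

end Summit.NavierStokesRegularity.NavierStokesRegularity.Theorems
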